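import Mathlib.MeasureTheory.Integral.Prod
import Mathlib.MeasureTheory.Function.StronglyMeasurable.Basic
import Mathlib.Analysis.InnerProductSpace.Basic
import Literature.MathematicalPhysics.QuantumLattice.OSAxiomsMeasure
import Literature.MathematicalPhysics.QuantumLattice.SchwartzTranslationCutoff
import Literature.MathematicalPhysics.QuantumLattice.OSContractionSemigroup
import HarnessLib

/-!
# Ergodicity implies clustering — discharge of `Literature.MathematicalPhysics.QuantumLattice.IsOS4Ergodic.clustering`

Trunk **T-AQFT** (topic `MathematicalPhysics/QuantumLattice`), families `constructive-qft`,
`crit-ising`; sibling proofs file of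
`Literature/MathematicalPhysics/QuantumLattice/OSAxiomsMeasure.lean`.

This file proves the named literature facts `Literature.MathematicalPhysics.QuantumLattice.IsOS4Ergodic.clustering` and
`Literature.MathematicalPhysics.QuantumLattice.IsOSMeasure.clustering` stated there: for a probability measure `μ` on `𝒮'(ℝ^d)`
satisfying OS2 (Euclidean invariance), OS3 (reflection positivity, Glimm–Jaffe (6.1.4)) and OS4
in the mean-ergodic form (6.1.5) (`IsOS4Ergodic`: `T⁻¹ ∫₀ᵀ F ∘ T_t dt → ∫ F dμ` in `L²(μ)`),
the generating functional clusters, `S{f + T_t g} → S{f} S{g}` as `t → +∞` for all real test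
functions `f, g` (`IsOS4Clustering`).

## Source and proof

J. Glimm, A. Jaffe, *Quantum Physics: a functional integral point of view* (2nd ed. 1987)
[GlimmJaffeQP1987]: Thm 6.1.3 (pp. 88–89, reconstruction of the transfer semigroup
`R(t) = T(t)^ = e^{-tH}` on `𝓔₊/𝒩` from reflection positivity and time-translation invariance:
(i) semigroup, (ii) hermitian, (iii) contraction) and Thm 19.7.1 with the Remark following it
(pp. 314–315): under OS0–3, OS4 ⇔ `Ω` is the unique invariant vector of `e^{-tH}`; ergodicity is
equivalent to the (Cesàro) cluster property (19.7.1)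
`0 = lim t⁻¹ ∫₀ᵗ [⟨A T(s) B⟩ - ⟨A⟩⟨B⟩] ds`, where WLOG `A ∈ 𝓔₋`, `B ∈ 𝓔₊` by the time translation,
which reads (19.7.2) `⟨(θA)^, e^{-sH} B^⟩ → ⟨(θA)^, Ω⟩⟨Ω, B^⟩` in Cesàro mean.

The vendored fact asks for the *pointwise* limit in `t`; the printed argument gives it once one
knows that `e^{-tH} B^` converges strongly (GJ: `st-lim t⁻¹∫₀ᵗ e^{-sH} ds = P_inv` by the spectral
theorem). We follow the printed architecture in elementary form (no completion, no quotient by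
null vectors, no spectral theorem — Mathlib has none for unbounded self-adjoint operators):

1. `posTimeSpan d` is `𝓔₊`, the span of the exponentials `e_h = exp(i ω(h))`, `h` positive-time;
   `osForm μ F G = ∫ conj(F(θω)) G(ω) dμ` is the OS form (6.1.11), positive semidefinite and
   Hermitian on `𝓔₊` by OS3 (`IsOS3ReflectionPositive.osSesq_self_nonneg`, polarisation), whence a
   `PreInnerProductSpace.Core` (`IsOS3ReflectionPositive.core`, GJ Prop. 6.1.1 without quotient).
2. `shiftOpPos d t` is `T(t)` restricted to `𝓔₊` (`t ≥ 0`): a semigroup (Thm 6.1.3 (i)),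
   symmetric for the OS form by OS2 (`IsOS2Invariant.osForm_shiftOp`, Thm 6.1.3 (ii):
   `⟨θT(t)A, B⟩ = ⟨T(-t)θA, B⟩ = ⟨θA, T(t)B⟩`), with bounded orbits. The abstract lemma
   `exists_tendsto_inner_semigroup` (file `OSContractionSemigroup`, GJ Thm 6.1.3 (iii) plus the
   monotone-limit argument) gives convergence of `t ↦ b(e_f, T(t) e_g) = S{-θf + T_t g}`.
3. The limit is identified by ergodicity: Fubini turns the Cesàro mean of
   `k(t) = ∫ conj(e_h ∘ T_t) e_g dμ` into `⟨timeAverage_T e_h, e_g⟩_{L²}`, which tends to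
   `conj(S{h}) S{g}` by `IsOS4Ergodic` (`IsOS4Ergodic.tendsto_cesaro_shiftCorr`, GJ (19.7.1));
   Cesàro means of a convergent function converge to its limit
   (`tendsto_inv_smul_intervalIntegral`). This proves clustering for `θf, g` positive-time
   (`IsOS4Ergodic.tendsto_genFunctional_add_timeShiftTest`, GJ (19.7.2) pointwise).
4. General `f, g ∈ 𝓢`: GJ take `f ∈ C₀^∞` and translate in time. We approximate `f, g` in `𝓢` by
   compactly supported cutoffs (`exists_tsupport_subset_closedBall_tendsto`, file
   `SchwartzTranslationCutoff`), move them to negative/positive times with OS2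
   (`S{T_s h} = S{h}`), and control the error uniformly in `t` by
   `|S{h₁} - S{h₂}| ≤ δ(h₁ - h₂)`, `δ(h) = ∫ |e_h - 1| dμ`, which is subadditive, translation
   invariant and tends to `0` along `𝓢`-convergent sequences (dominated convergence).

Joint measurability of `(t, ω) ↦ e_h(T_t ω)` (needed for Fubini) comes from the strong continuity
of translations on `𝓢` (`continuous_compSubConstCLM`). OS0 and OS1 are not used, as recorded in
the docstring of the fact.

## Mathlib

Used: `PointwiseConvergenceCLM` (weak-* dual, `FieldConfig`), `SchwartzMap`, Bochner and interval
integrals (`integral_integral_swap`, `MeasurePreserving.integral_comp`), `eLpNorm` monotonicity in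
the exponent, `InnerProductSpace.ofCore` on a `PreInnerProductSpace.Core` (semidefinite),
`measurable_uncurry_of_continuous_of_measurable`. Searched and absent at the pin: OS axioms /
reconstruction (`OsterwalderSchrader`, `reflectionPositiv`: no hits); Mathlib's von Neumann mean
ergodic theorem (`Mathlib/Analysis/InnerProductSpace/MeanErgodic.lean`,
`ContinuousLinearMap.tendsto_birkhoffAverage_orthogonalProjection`) is for the iterates of a single
operator (discrete Birkhoff averages), not for one-parameter (semi)groups, and is not needed here:
ergodicity is a hypothesis, and the semigroup limit is obtained by the elementary monotone
argument of `OSContractionSemigroup`.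
-/

open scoped SchwartzMap ComplexConjugate InnerProductSpace
open MeasureTheory Filter Topology Complex Set

namespace Literature.MathematicalPhysics.QuantumLattice

variable {d : ℕ} [NeZero d]

/-! ### Kinematics of time translations and time reflection -/

section Kinematics

variable (d)

/-- `T₀ = id` on test functions. [folklore] -/
@[simp]
theorem timeShiftTest_zero (f : 𝓢(EuclideanSpace ℝ (Fin d), ℝ)) : timeShiftTest d 0 f = f := by
  ext x
  simp [timeShiftTest_apply, PiLp.single, WithLp.toLp_zero]

/-- `T_{s+t} = T_s ∘ T_t` on test functions. [folklore] -/
theorem timeShiftTest_add (s t : ℝ) (f : 𝓢(EuclideanSpace ℝ (Fin d), ℝ)) :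
    timeShiftTest d (s + t) f = timeShiftTest d s (timeShiftTest d t f) := by
  ext x
  simp only [timeShiftTest_apply]
  congr 1
  rw [show EuclideanSpace.single (0 : Fin d) (s + t)
      = EuclideanSpace.single 0 s + EuclideanSpace.single 0 t from PiLp.single_add 2 0]
  abel

/-- `t ↦ t e₀` is continuous. [folklore] -/
theorem continuous_single_time :
    Continuous fun t : ℝ => (EuclideanSpace.single (0 : Fin d) t : EuclideanSpace ℝ (Fin d)) := by
  change Continuous fun t : ℝ => WithLp.toLp 2 (Pi.single (M := fun _ : Fin d => ℝ) 0 t)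
  exact (PiLp.continuous_toLp 2 _).comp (continuous_single (A := fun _ : Fin d => ℝ) 0 :)

/-- Strong continuity of time translations on Schwartz space: `t ↦ T_t f` is continuous
`ℝ → 𝓢(ℝ^d)` (from `continuous_compSubConstCLM`). Hörmander I §7.1. [folklore] -/
theorem continuous_timeShiftTest (f : 𝓢(EuclideanSpace ℝ (Fin d), ℝ)) :
    Continuous fun t : ℝ => timeShiftTest d t f :=
  (continuous_compSubConstCLM ℝ f).comp (continuous_single_time d)

/-- `T₀ = id` on configurations. [folklore] -/
@[simp]
theorem timeShiftField_zero (ω : FieldConfig (EuclideanSpace ℝ (Fin d))) :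
    timeShiftField d 0 ω = ω := by
  ext f
  rw [timeShiftField_apply, neg_zero, timeShiftTest_zero]

/-- `T_t ∘ T_{-t} = id` on configurations. [folklore] -/
@[simp]
theorem timeShiftField_neg_apply (t : ℝ) (ω : FieldConfig (EuclideanSpace ℝ (Fin d))) :
    timeShiftField d t (timeShiftField d (-t) ω) = ω := by
  rw [← ContinuousLinearMap.comp_apply, ← timeShiftField_add, add_neg_cancel, timeShiftField_zero]

/-- `T_{-t} ∘ T_t = id` on configurations. [folklore] -/
@[simp]
theorem timeShiftField_neg_apply' (t : ℝ) (ω : FieldConfig (EuclideanSpace ℝ (Fin d))) :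
    timeShiftField d (-t) (timeShiftField d t ω) = ω := by
  simpa using timeShiftField_neg_apply d (-t) ω

/-- Time translations of configurations as homeomorphisms (inverse `T_{-t}`). [folklore] -/
noncomputable def timeShiftHomeomorph (t : ℝ) :
    FieldConfig (EuclideanSpace ℝ (Fin d)) ≃ₜ FieldConfig (EuclideanSpace ℝ (Fin d)) where
  toFun := timeShiftField d t
  invFun := timeShiftField d (-t)
  left_inv ω := timeShiftField_neg_apply' d t ω
  right_inv ω := timeShiftField_neg_apply d t ω
  continuous_toFun := (timeShiftField d t).continuous
  continuous_invFun := (timeShiftField d (-t)).continuous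

/-- Time reflection negates the time unit vector: `θ (t e₀) = -(t e₀)`. [folklore] -/
theorem timeReflection_single (t : ℝ) :
    timeReflection d (EuclideanSpace.single 0 t) = -EuclideanSpace.single 0 t := by
  ext i
  simp only [timeReflection_apply, PiLp.neg_apply]
  split_ifs with h
  · rfl
  · simp [h]

/-- Time reflection conjugates time translation to its inverse on test functions:
`Θ (T_t f) = T_{-t} (Θ f)` (OS 1973 §2). [folklore] -/
theorem thetaTest_timeShiftTest (t : ℝ) (f : 𝓢(EuclideanSpace ℝ (Fin d), ℝ)) :
    thetaTest d (timeShiftTest d t f) = timeShiftTest d (-t) (thetaTest d f) := by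
  ext x
  simp only [thetaTest_apply, timeShiftTest_apply, map_sub, timeReflection_single]
  congr 1
  rw [show EuclideanSpace.single (0 : Fin d) (-t) = -EuclideanSpace.single 0 t from
    PiLp.single_neg 2 0]
  abel

/-- Time reflection conjugates time translation to its inverse on configurations:
`Θ (T_t ω) = T_{-t} (Θ ω)`. [folklore] -/
theorem thetaField_timeShiftField (t : ℝ) (ω : FieldConfig (EuclideanSpace ℝ (Fin d))) :
    thetaField d (timeShiftField d t ω) = timeShiftField d (-t) (thetaField d ω) := by
  ext f
  simp only [thetaField_apply, timeShiftField_apply, neg_neg, thetaTest_timeShiftTest]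

end Kinematics

/-! ### Positive-time test functions under time translation -/

/-- Time translation by `t ≥ 0` preserves positive-time test functions (the fact
`IsPositiveTime.timeShiftTest` of `EuclideanAction`, discharged there as
`IsPositiveTime.timeShiftTest_holds`; restated with explicit arguments). OS 1973 §2. [folklore] -/
theorem isPositiveTime_timeShiftTest_of_nonneg {f : 𝓢(EuclideanSpace ℝ (Fin d), ℝ)}
    (hf : IsPositiveTime f) {t : ℝ} (ht : 0 ≤ t) : IsPositiveTime (timeShiftTest d t f) :=
  IsPositiveTime.timeShiftTest_holds hf ht

/-- If `θ f` is positive-time then so is `-(θ f) = θ (-f)`, and `θ (-(θ f)) = -f`. [folklore] -/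
theorem thetaTest_neg_thetaTest (f : 𝓢(EuclideanSpace ℝ (Fin d), ℝ)) :
    thetaTest d (-(thetaTest d f)) = -f := by
  rw [map_neg, thetaTest_involutive]

/-- Positive time is preserved by negation (`supp (-f) = supp f`). [folklore] -/
theorem isPositiveTime_neg {f : 𝓢(EuclideanSpace ℝ (Fin d), ℝ)} (hf : IsPositiveTime f) :
    IsPositiveTime (-f) := by
  intro x hx
  apply hf
  have hcoe : (⇑(-f) : EuclideanSpace ℝ (Fin d) → ℝ) = -⇑f := rfl
  rwa [hcoe, tsupport_neg] at hx

/-! ### Exponential observables -/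

/-- The exponential observable `e_h(ω) = exp (i ω(h))` on configurations; the generating
functional is `S{h} = ∫ e_h dμ` (Glimm–Jaffe (6.1.4), (6.1.6)). [folklore] -/
noncomputable def expObs (h : 𝓢(EuclideanSpace ℝ (Fin d), ℝ))
    (ω : FieldConfig (EuclideanSpace ℝ (Fin d))) : ℂ :=
  cexp (I * (ω h : ℂ))

omit [NeZero d] in
/-- `e_h` is continuous for the weak-* topology. [folklore] -/
theorem continuous_expObs (h : 𝓢(EuclideanSpace ℝ (Fin d), ℝ)) : Continuous (expObs h) := by
  unfold expObs
  fun_prop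

omit [NeZero d] in
/-- `e_h` is measurable. [folklore] -/
theorem measurable_expObs (h : 𝓢(EuclideanSpace ℝ (Fin d), ℝ)) : Measurable (expObs h) :=
  (continuous_expObs h).measurable

omit [NeZero d] in
/-- `|e_h(ω)| = 1`. [folklore] -/
@[simp]
theorem norm_expObs (h : 𝓢(EuclideanSpace ℝ (Fin d), ℝ))
    (ω : FieldConfig (EuclideanSpace ℝ (Fin d))) : ‖expObs h ω‖ = 1 := by
  rw [expObs, mul_comm, Complex.norm_exp_ofReal_mul_I]

omit [NeZero d] in
/-- `e_h e_g = e_{h+g}`. [folklore] -/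
theorem expObs_mul (h g : 𝓢(EuclideanSpace ℝ (Fin d), ℝ))
    (ω : FieldConfig (EuclideanSpace ℝ (Fin d))) :
    expObs h ω * expObs g ω = expObs (h + g) ω := by
  simp only [expObs, map_add, ofReal_add, mul_add, Complex.exp_add]

omit [NeZero d] in
/-- `conj e_h = e_{-h}`. [folklore] -/
theorem conj_expObs (h : 𝓢(EuclideanSpace ℝ (Fin d), ℝ))
    (ω : FieldConfig (EuclideanSpace ℝ (Fin d))) :
    conj (expObs h ω) = expObs (-h) ω := by
  simp only [expObs, ← Complex.exp_conj, map_mul, Complex.conj_I, Complex.conj_ofReal, map_neg,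
    ofReal_neg]
  ring_nf

omit [NeZero d] in
/-- `∫ e_h dμ = S{h}`. [folklore] -/
theorem integral_expObs (μ : Measure (FieldConfig (EuclideanSpace ℝ (Fin d))))
    (h : 𝓢(EuclideanSpace ℝ (Fin d), ℝ)) : ∫ ω, expObs h ω ∂μ = genFunctional μ h := rfl

/-- `e_h ∘ T_t = e_{T_{-t} h}`. [folklore] -/
theorem expObs_timeShiftField (h : 𝓢(EuclideanSpace ℝ (Fin d), ℝ)) (t : ℝ)
    (ω : FieldConfig (EuclideanSpace ℝ (Fin d))) :
    expObs h (timeShiftField d t ω) = expObs (timeShiftTest d (-t) h) ω := by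
  simp only [expObs, timeShiftField_apply]

/-- `e_h ∘ Θ = e_{Θ h}`. [folklore] -/
theorem expObs_thetaField (h : 𝓢(EuclideanSpace ℝ (Fin d), ℝ))
    (ω : FieldConfig (EuclideanSpace ℝ (Fin d))) :
    expObs h (thetaField d ω) = expObs (thetaTest d h) ω := by
  simp only [expObs, thetaField_apply]

omit [NeZero d] in
/-- A continuous bounded complex observable is integrable for a finite law. [folklore] -/
theorem integrable_of_continuous_of_bound {μ : Measure (FieldConfig (EuclideanSpace ℝ (Fin d)))}
    [IsFiniteMeasure μ] {F : FieldConfig (EuclideanSpace ℝ (Fin d)) → ℂ} (hF : Continuous F)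
    (C : ℝ) (hC : ∀ ω, ‖F ω‖ ≤ C) : Integrable F μ :=
  (integrable_const C).mono' hF.aestronglyMeasurable (ae_of_all _ hC)

/-! ### Time-translation invariance from OS2 -/

/-- Time translation of configurations is the Euclidean action of the translation by `t e₀`.
[folklore] -/
theorem timeShiftField_eq_euclidActField (t : ℝ) :
    timeShiftField d t = euclidActField
      (AffineIsometryEquiv.constVAdd ℝ (EuclideanSpace ℝ (Fin d)) (EuclideanSpace.single 0 t)) := by
  have hT : (translateTest (-EuclideanSpace.single (0 : Fin d) t) :
      𝓢(EuclideanSpace ℝ (Fin d), ℝ) →L[ℝ] 𝓢(EuclideanSpace ℝ (Fin d), ℝ)) =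
      euclidActTest (AffineIsometryEquiv.constVAdd ℝ (EuclideanSpace ℝ (Fin d))
        (EuclideanSpace.single 0 t)).symm := by
    ext f x
    simp only [translateTest_apply, euclidActTest_apply, AffineIsometryEquiv.symm_symm,
      AffineIsometryEquiv.coe_constVAdd, vadd_eq_add, sub_neg_eq_add, add_comm]
  change translateField (EuclideanSpace.single 0 t) = _
  unfold translateField euclidActField
  rw [hT]

/-- Under OS2, `μ` is invariant under time translations: `(T_t)_* μ = μ`. Glimm–Jaffe §6.1 (OS2).
[folklore] -/
theorem IsOS2Invariant.measurePreserving_timeShiftField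
    {μ : Measure (FieldConfig (EuclideanSpace ℝ (Fin d)))} (h2 : IsOS2Invariant μ) (t : ℝ) :
    MeasurePreserving (timeShiftField d t) μ μ :=
  ⟨(timeShiftField d t).continuous.measurable, by rw [timeShiftField_eq_euclidActField]; exact h2 _⟩

/-- Change of variables under time translation for an OS2 law: `∫ F(T_t ω) dμ = ∫ F dμ`
(no measurability needed, `T_t` being a homeomorphism). [folklore] -/
theorem IsOS2Invariant.integral_comp_timeShiftField {G : Type*} [NormedAddCommGroup G]
    [NormedSpace ℝ G] {μ : Measure (FieldConfig (EuclideanSpace ℝ (Fin d)))}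
    (h2 : IsOS2Invariant μ) (t : ℝ) (F : FieldConfig (EuclideanSpace ℝ (Fin d)) → G) :
    ∫ ω, F (timeShiftField d t ω) ∂μ = ∫ ω, F ω ∂μ :=
  (h2.measurePreserving_timeShiftField t).integral_comp (timeShiftHomeomorph d t).measurableEmbedding F

/-! ### Joint measurability of the flow on exponential observables -/

/-- `(t, ω) ↦ (T_t ω)(h) = ω(T_{-t} h)` is jointly measurable: continuous in `t` (strong
continuity of translations on `𝓢`) and measurable in `ω`. [folklore] -/
theorem measurable_uncurry_timeShiftField_eval (h : 𝓢(EuclideanSpace ℝ (Fin d), ℝ)) :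
    Measurable (Function.uncurry fun (t : ℝ) (ω : FieldConfig (EuclideanSpace ℝ (Fin d))) =>
      timeShiftField d t ω h) := by
  refine measurable_uncurry_of_continuous_of_measurable (fun ω => ?_) (fun t => ?_)
  · simp only [timeShiftField_apply]
    exact ω.continuous.comp ((continuous_timeShiftTest d h).comp continuous_neg)
  · simp only [timeShiftField_apply]
    exact measurable_eval _

/-- `(t, ω) ↦ e_h(T_t ω)` is jointly measurable. [folklore] -/
theorem measurable_uncurry_expObs_timeShiftField (h : 𝓢(EuclideanSpace ℝ (Fin d), ℝ)) :
    Measurable (Function.uncurry fun (t : ℝ) (ω : FieldConfig (EuclideanSpace ℝ (Fin d))) =>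
      expObs h (timeShiftField d t ω)) := by
  have := (Complex.measurable_ofReal.comp (measurable_uncurry_timeShiftField_eval h))
  exact ((measurable_const.mul this).cexp :)

/-- `(ω, t) ↦ e_h(T_t ω)` is jointly measurable (arguments swapped). [folklore] -/
theorem measurable_uncurry_expObs_timeShiftField' (h : 𝓢(EuclideanSpace ℝ (Fin d), ℝ)) :
    Measurable (Function.uncurry fun (ω : FieldConfig (EuclideanSpace ℝ (Fin d))) (t : ℝ) =>
      expObs h (timeShiftField d t ω)) := by
  have heq : (Function.uncurry fun (ω : FieldConfig (EuclideanSpace ℝ (Fin d))) (t : ℝ) =>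
      expObs h (timeShiftField d t ω)) =
      (Function.uncurry fun (t : ℝ) (ω : FieldConfig (EuclideanSpace ℝ (Fin d))) =>
        expObs h (timeShiftField d t ω)) ∘ Prod.swap := by
    funext ⟨ω, t⟩
    simp only [Function.uncurry_apply_pair, Function.comp_apply, Prod.swap_prod_mk]
  rw [heq]
  exact (measurable_uncurry_expObs_timeShiftField h).comp measurable_swap

/-! ### The ergodic average of exponential observables -/

section Ergodic

/-- The time-shifted correlation `k(t) = ∫ conj(e_h(T_t ω)) e_g(ω) dμ(ω)` of two exponential
observables (Glimm–Jaffe (19.7.1) with `A = conj e_h`, `B = e_g`). [folklore] -/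
noncomputable def shiftCorr (μ : Measure (FieldConfig (EuclideanSpace ℝ (Fin d))))
    (h g : 𝓢(EuclideanSpace ℝ (Fin d), ℝ)) (t : ℝ) : ℂ :=
  ∫ ω, conj (expObs h (timeShiftField d t ω)) * expObs g ω ∂μ

/-- The integrand of `shiftCorr` is jointly measurable in `(t, ω)`. [folklore] -/
theorem measurable_uncurry_shiftCorr_integrand (h g : 𝓢(EuclideanSpace ℝ (Fin d), ℝ)) :
    Measurable (Function.uncurry fun (t : ℝ) (ω : FieldConfig (EuclideanSpace ℝ (Fin d))) =>
      conj (expObs h (timeShiftField d t ω)) * expObs g ω) := by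
  have heq : (Function.uncurry fun (t : ℝ) (ω : FieldConfig (EuclideanSpace ℝ (Fin d))) =>
      conj (expObs h (timeShiftField d t ω)) * expObs g ω) = fun p =>
      conj (Function.uncurry (fun (t : ℝ) (ω : FieldConfig (EuclideanSpace ℝ (Fin d))) =>
        expObs h (timeShiftField d t ω)) p) * expObs g p.2 := by
    funext ⟨t, ω⟩
    simp only [Function.uncurry_apply_pair]
  rw [heq]
  exact (Complex.continuous_conj.measurable.comp (measurable_uncurry_expObs_timeShiftField h)).mul
    ((measurable_expObs g).comp measurable_snd)

/-- The integrand of `shiftCorr` is jointly measurable in `(ω, t)`. [folklore] -/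
theorem measurable_uncurry_shiftCorr_integrand' (h g : 𝓢(EuclideanSpace ℝ (Fin d), ℝ)) :
    Measurable (Function.uncurry fun (ω : FieldConfig (EuclideanSpace ℝ (Fin d))) (t : ℝ) =>
      conj (expObs h (timeShiftField d t ω)) * expObs g ω) := by
  have heq : (Function.uncurry fun (ω : FieldConfig (EuclideanSpace ℝ (Fin d))) (t : ℝ) =>
      conj (expObs h (timeShiftField d t ω)) * expObs g ω) = fun p =>
      conj (Function.uncurry (fun (ω : FieldConfig (EuclideanSpace ℝ (Fin d))) (t : ℝ) =>
        expObs h (timeShiftField d t ω)) p) * expObs g p.1 := by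
    funext ⟨ω, t⟩
    simp only [Function.uncurry_apply_pair]
  rw [heq]
  exact (Complex.continuous_conj.measurable.comp (measurable_uncurry_expObs_timeShiftField' h)).mul
    ((measurable_expObs g).comp measurable_fst)

variable {μ : Measure (FieldConfig (EuclideanSpace ℝ (Fin d)))}

/-- `|k(t)| ≤ 1` for a probability law. [folklore] -/
theorem norm_shiftCorr_le [IsProbabilityMeasure μ] (h g : 𝓢(EuclideanSpace ℝ (Fin d), ℝ)) (t : ℝ) :
    ‖shiftCorr μ h g t‖ ≤ 1 := by
  unfold shiftCorr
  calc ‖∫ ω, conj (expObs h (timeShiftField d t ω)) * expObs g ω ∂μ‖ ≤ 1 * μ.real univ :=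
        norm_integral_le_of_norm_le_const (ae_of_all _ fun ω => by simp)
    _ = 1 := by simp

/-- `k` is measurable (Fubini). [folklore] -/
theorem measurable_shiftCorr [SFinite μ] (h g : 𝓢(EuclideanSpace ℝ (Fin d), ℝ)) :
    StronglyMeasurable (shiftCorr μ h g) :=
  StronglyMeasurable.integral_prod_right
    (measurable_uncurry_shiftCorr_integrand h g).stronglyMeasurable

/-- `k` is integrable on every bounded interval. [folklore] -/
theorem intervalIntegrable_shiftCorr [IsProbabilityMeasure μ] (h g : 𝓢(EuclideanSpace ℝ (Fin d), ℝ))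
    (a b : ℝ) : IntervalIntegrable (shiftCorr μ h g) volume a b := by
  rw [intervalIntegrable_iff]
  refine Measure.integrableOn_of_bounded ?_ (measurable_shiftCorr h g).aestronglyMeasurable
    (ae_of_all _ fun t => norm_shiftCorr_le h g t)
  rw [uIoc, Real.volume_Ioc]
  exact ENNReal.ofReal_ne_top

/-- Fubini for the time average: `∫ conj(timeAverage_T e_h) e_g dμ = T⁻¹ ∫₀ᵀ k(t) dt` for
`T > 0`. [folklore] -/
theorem integral_conj_timeAverage_mul [IsProbabilityMeasure μ]
    (h g : 𝓢(EuclideanSpace ℝ (Fin d), ℝ)) {T : ℝ} (hT : 0 < T) :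
    ∫ ω, conj (timeAverage d T (expObs h) ω) * expObs g ω ∂μ =
      T⁻¹ • ∫ t in (0 : ℝ)..T, shiftCorr μ h g t := by
  have hP : Integrable (Function.uncurry fun (ω : FieldConfig (EuclideanSpace ℝ (Fin d))) (t : ℝ) =>
      conj (expObs h (timeShiftField d t ω)) * expObs g ω)
      (μ.prod (volume.restrict (Ioc (0 : ℝ) T))) := by
    refine (integrable_const (1 : ℝ)).mono'
      (measurable_uncurry_shiftCorr_integrand' h g).aestronglyMeasurable (ae_of_all _ fun p => ?_)
    obtain ⟨ω, t⟩ := p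
    simp only [Function.uncurry_apply_pair, norm_mul, RCLike.norm_conj, norm_expObs, mul_one, le_refl]
  have hconj : ∀ ω, conj (timeAverage d T (expObs h) ω) * expObs g ω =
      (T⁻¹ : ℂ) * ∫ t in Ioc (0 : ℝ) T, conj (expObs h (timeShiftField d t ω)) * expObs g ω := by
    intro ω
    rw [timeAverage, intervalIntegral.integral_of_le hT.le, Complex.real_smul, map_mul,
      Complex.conj_ofReal, ← integral_conj, ofReal_inv, mul_assoc, ← integral_mul_const]
  simp_rw [hconj]
  rw [integral_const_mul, integral_integral_swap hP, intervalIntegral.integral_of_le hT.le,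
    Complex.real_smul, ofReal_inv]
  simp only [shiftCorr]

/-- The time average of an exponential observable is (strongly) measurable. [folklore] -/
theorem stronglyMeasurable_timeAverage_expObs (h : 𝓢(EuclideanSpace ℝ (Fin d), ℝ)) (T : ℝ) :
    StronglyMeasurable (timeAverage d T (expObs h)) := by
  have hEswap := measurable_uncurry_expObs_timeShiftField' (d := d) h
  have h1 : StronglyMeasurable fun ω : FieldConfig (EuclideanSpace ℝ (Fin d)) =>
      ∫ t in Ioc (0 : ℝ) T, expObs h (timeShiftField d t ω) :=
    StronglyMeasurable.integral_prod_right (ν := volume.restrict (Ioc (0 : ℝ) T))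
      hEswap.stronglyMeasurable
  have h2 : StronglyMeasurable fun ω : FieldConfig (EuclideanSpace ℝ (Fin d)) =>
      ∫ t in Ioc T (0 : ℝ), expObs h (timeShiftField d t ω) :=
    StronglyMeasurable.integral_prod_right (ν := volume.restrict (Ioc T (0 : ℝ)))
      hEswap.stronglyMeasurable
  have : timeAverage d T (expObs h) = fun ω => T⁻¹ • ((∫ t in Ioc (0 : ℝ) T,
      expObs h (timeShiftField d t ω)) - ∫ t in Ioc T (0 : ℝ), expObs h (timeShiftField d t ω)) := by
    funext ω
    simp only [timeAverage, intervalIntegral]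
  rw [this]
  exact (h1.sub h2).const_smul T⁻¹

/-- `|timeAverage_T e_h| ≤ 1` for `T > 0`. [folklore] -/
theorem norm_timeAverage_expObs_le (h : 𝓢(EuclideanSpace ℝ (Fin d), ℝ)) {T : ℝ} (hT : 0 < T)
    (ω : FieldConfig (EuclideanSpace ℝ (Fin d))) : ‖timeAverage d T (expObs h) ω‖ ≤ 1 := by
  rw [timeAverage, norm_smul, norm_inv, Real.norm_of_nonneg hT.le]
  have : ‖∫ t in (0 : ℝ)..T, expObs h (timeShiftField d t ω)‖ ≤ 1 * |T - 0| :=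
    intervalIntegral.norm_integral_le_of_norm_le_const fun t _ => (norm_expObs _ _).le
  rw [sub_zero, abs_of_pos hT, one_mul] at this
  calc T⁻¹ * ‖∫ t in (0 : ℝ)..T, expObs h (timeShiftField d t ω)‖ ≤ T⁻¹ * T := by gcongr
    _ = 1 := inv_mul_cancel₀ hT.ne'

/-- Mean ergodicity gives `⟨timeAverage_T e_h, e_g⟩_{L²} → conj(S{h}) S{g}`. Glimm–Jaffe §19.7.
[cite: GlimmJaffeQP1987, §19.7 Remark after Thm 19.7.1] -/
theorem IsOS4Ergodic.tendsto_integral_conj_timeAverage_mul [IsProbabilityMeasure μ]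
    (h4 : IsOS4Ergodic d μ) (h g : 𝓢(EuclideanSpace ℝ (Fin d), ℝ)) :
    Tendsto (fun T : ℝ => ∫ ω, conj (timeAverage d T (expObs h) ω) * expObs g ω ∂μ) atTop
      (𝓝 (conj (genFunctional μ h) * genFunctional μ g)) := by
  have hmem : MemLp (expObs h) 2 μ :=
    MemLp.of_bound (continuous_expObs h).aestronglyMeasurable 1
      (ae_of_all _ fun ω => (norm_expObs h ω).le)
  have h4' := h4 (expObs h) hmem
  rw [integral_expObs] at h4'
  rw [tendsto_iff_norm_sub_tendsto_zero]
  have hreal : Tendsto (fun T : ℝ => (eLpNorm (fun ω => timeAverage d T (expObs h) ω -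
      genFunctional μ h) 2 μ).toReal) atTop (𝓝 0) := by
    rw [← ENNReal.toReal_zero]
    exact (ENNReal.tendsto_toReal ENNReal.zero_ne_top).comp h4'
  have hfin : ∀ᶠ T : ℝ in atTop,
      eLpNorm (fun ω => timeAverage d T (expObs h) ω - genFunctional μ h) 2 μ < ⊤ :=
    (h4'.eventually_lt_const (u := 1) (by norm_num)).mono fun T hT => hT.trans ENNReal.one_lt_top
  refine squeeze_zero' (Eventually.of_forall fun T => norm_nonneg _) ?_ hreal
  filter_upwards [hfin, eventually_gt_atTop (0 : ℝ)] with T hT hT0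
  have hAsm := stronglyMeasurable_timeAverage_expObs (d := d) h T
  have hDint : Integrable (fun ω => conj (timeAverage d T (expObs h) ω) * expObs g ω) μ :=
    (integrable_const (1 : ℝ)).mono'
      ((Complex.continuous_conj.measurable.comp_aemeasurable
        hAsm.measurable.aemeasurable).aestronglyMeasurable.mul
        (continuous_expObs g).aestronglyMeasurable)
      (ae_of_all _ fun ω => by
        simpa using norm_timeAverage_expObs_le h hT0 ω)
  have hGint : Integrable (fun ω => conj (genFunctional μ h) * expObs g ω) μ :=
    (integrable_of_continuous_of_bound (continuous_expObs g) 1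
      fun ω => (norm_expObs g ω).le).const_mul _
  have hdiff : (∫ ω, conj (timeAverage d T (expObs h) ω) * expObs g ω ∂μ) -
      conj (genFunctional μ h) * genFunctional μ g =
      ∫ ω, conj (timeAverage d T (expObs h) ω - genFunctional μ h) * expObs g ω ∂μ := by
    rw [← integral_expObs μ g, ← integral_const_mul, ← integral_sub hDint hGint]
    congr 1
    funext ω
    rw [map_sub, sub_mul]
  rw [hdiff]
  have hDsm : AEStronglyMeasurable (fun ω => timeAverage d T (expObs h) ω - genFunctional μ h) μ :=
    (hAsm.sub stronglyMeasurable_const).aestronglyMeasurable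
  calc ‖∫ ω, conj (timeAverage d T (expObs h) ω - genFunctional μ h) * expObs g ω ∂μ‖
      ≤ ∫ ω, ‖conj (timeAverage d T (expObs h) ω - genFunctional μ h) * expObs g ω‖ ∂μ :=
        norm_integral_le_integral_norm _
    _ = ∫ ω, ‖timeAverage d T (expObs h) ω - genFunctional μ h‖ ∂μ := by
        congr 1; funext ω; rw [norm_mul, norm_expObs, mul_one, RCLike.norm_conj]
    _ = (eLpNorm (fun ω => timeAverage d T (expObs h) ω - genFunctional μ h) 1 μ).toReal := by
        rw [integral_norm_eq_lintegral_enorm hDsm, eLpNorm_one_eq_lintegral_enorm]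
    _ ≤ (eLpNorm (fun ω => timeAverage d T (expObs h) ω - genFunctional μ h) 2 μ).toReal :=
        ENNReal.toReal_mono hT.ne (eLpNorm_le_eLpNorm_of_exponent_le (by norm_num) hDsm)

/-- **Ergodic averages of correlations** (Glimm–Jaffe (6.1.10) ⇒ (19.7.1)): if time translations
act ergodically on `(𝒮', μ)` in the mean (`IsOS4Ergodic`), then for exponential observables the
Cesàro means of the correlation converge to the product of expectations,
`T⁻¹ ∫₀ᵀ ∫ conj(e_h ∘ T_t) e_g dμ dt → conj(S{h}) S{g}`. Fubini turns the left side into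
`⟨timeAverage_T e_h, e_g⟩_{L²}`, and `L²`-convergence of the time average gives the limit.
[cite: GlimmJaffeQP1987, §19.7 Remark after Thm 19.7.1] -/
theorem IsOS4Ergodic.tendsto_cesaro_shiftCorr [IsProbabilityMeasure μ] (h4 : IsOS4Ergodic d μ)
    (h g : 𝓢(EuclideanSpace ℝ (Fin d), ℝ)) :
    Tendsto (fun T : ℝ => T⁻¹ • ∫ t in (0 : ℝ)..T, shiftCorr μ h g t) atTop
      (𝓝 (conj (genFunctional μ h) * genFunctional μ g)) := by
  refine (h4.tendsto_integral_conj_timeAverage_mul h g).congr' ?_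
  filter_upwards [eventually_gt_atTop (0 : ℝ)] with T hT
  exact integral_conj_timeAverage_mul h g hT

end Ergodic

/-! ### The positive-time algebra `𝓔₊`, the OS form and the transfer semigroup -/

section Reconstruction

variable (d)

/-- The positive-time exponential algebra `𝓔₊`: the complex span of the observables `e_h`,
`h` a positive-time real test function (Glimm–Jaffe §6.1, `𝒜₊` of (6.1.6) and OS3). [folklore] -/
noncomputable def posTimeSpan :
    Submodule ℂ (FieldConfig (EuclideanSpace ℝ (Fin d)) → ℂ) :=
  Submodule.span ℂ (expObs '' {h : 𝓢(EuclideanSpace ℝ (Fin d), ℝ) | IsPositiveTime h})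

variable {d}

/-- `e_h ∈ 𝓔₊` for positive-time `h`. [folklore] -/
theorem expObs_mem_posTimeSpan {h : 𝓢(EuclideanSpace ℝ (Fin d), ℝ)} (hh : IsPositiveTime h) :
    expObs h ∈ posTimeSpan d :=
  Submodule.subset_span ⟨h, hh, rfl⟩

/-- Elements of `𝓔₊` are continuous bounded observables. [folklore] -/
theorem continuous_and_bounded_of_mem_posTimeSpan
    {F : FieldConfig (EuclideanSpace ℝ (Fin d)) → ℂ} (hF : F ∈ posTimeSpan d) :
    Continuous F ∧ ∃ C : ℝ, ∀ ω, ‖F ω‖ ≤ C := by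
  induction hF using Submodule.span_induction with
  | mem F hF =>
    obtain ⟨h, -, rfl⟩ := hF
    exact ⟨continuous_expObs h, 1, fun ω => (norm_expObs h ω).le⟩
  | zero => exact ⟨continuous_const, 0, fun ω => by simp⟩
  | add F G _ _ hF hG =>
    obtain ⟨hFc, C₁, hC₁⟩ := hF
    obtain ⟨hGc, C₂, hC₂⟩ := hG
    exact ⟨hFc.add hGc, C₁ + C₂, fun ω => (norm_add_le _ _).trans (add_le_add (hC₁ ω) (hC₂ ω))⟩
  | smul a F _ hF =>
    obtain ⟨hFc, C, hC⟩ := hF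
    refine ⟨hFc.const_smul a, ‖a‖ * C, fun ω => ?_⟩
    rw [Pi.smul_apply, norm_smul]
    exact mul_le_mul_of_nonneg_left (hC ω) (norm_nonneg _)

variable (d) in
/-- The time-translation operator `(V_s F)(ω) = F(T_{-s} ω)` on observables; on exponentials
`V_s e_h = e_{T_s h}` (Glimm–Jaffe (6.1.7)). [folklore] -/
noncomputable def shiftOp (s : ℝ) :
    (FieldConfig (EuclideanSpace ℝ (Fin d)) → ℂ) →ₗ[ℂ] (FieldConfig (EuclideanSpace ℝ (Fin d)) → ℂ) :=
  LinearMap.funLeft ℂ ℂ (timeShiftField d (-s))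

/-- `(V_s F)(ω) = F(T_{-s} ω)`. [folklore] -/
@[simp]
theorem shiftOp_apply (s : ℝ) (F : FieldConfig (EuclideanSpace ℝ (Fin d)) → ℂ)
    (ω : FieldConfig (EuclideanSpace ℝ (Fin d))) :
    shiftOp d s F ω = F (timeShiftField d (-s) ω) := rfl

/-- `V_s e_h = e_{T_s h}`. [folklore] -/
theorem shiftOp_expObs (s : ℝ) (h : 𝓢(EuclideanSpace ℝ (Fin d), ℝ)) :
    shiftOp d s (expObs h) = expObs (timeShiftTest d s h) := by
  funext ω
  rw [shiftOp_apply, expObs_timeShiftField, neg_neg]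

/-- `V_s 𝓔₊ ⊆ 𝓔₊` for `s ≥ 0` (Glimm–Jaffe Thm 6.1.3: "clearly `T(t) : 𝓔₊ → 𝓔₊`"). [folklore] -/
theorem shiftOp_mem_posTimeSpan {s : ℝ} (hs : 0 ≤ s)
    {F : FieldConfig (EuclideanSpace ℝ (Fin d)) → ℂ} (hF : F ∈ posTimeSpan d) :
    shiftOp d s F ∈ posTimeSpan d := by
  have hle : posTimeSpan d ≤ (posTimeSpan d).comap (shiftOp d s) := by
    refine Submodule.span_le.2 ?_
    rintro _ ⟨h, hh, rfl⟩
    change shiftOp d s (expObs h) ∈ posTimeSpan d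
    rw [shiftOp_expObs]
    exact expObs_mem_posTimeSpan (isPositiveTime_timeShiftTest_of_nonneg hh hs)
  exact hle hF

variable (d) in
/-- The transfer semigroup on `𝓔₊`: `V_{max t 0}` restricted to `𝓔₊` (only `t ≥ 0` is used;
Glimm–Jaffe Thm 6.1.3, `R(t) = T(t)^`). [folklore] -/
noncomputable def shiftOpPos (t : ℝ) : ↥(posTimeSpan d) →ₗ[ℂ] ↥(posTimeSpan d) :=
  (shiftOp d (max t 0)).restrict fun _ hF => shiftOp_mem_posTimeSpan (le_max_right t 0) hF

/-- Underlying function of `shiftOpPos`. [folklore] -/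
theorem coe_shiftOpPos (t : ℝ) (F : ↥(posTimeSpan d)) :
    ((shiftOpPos d t F : ↥(posTimeSpan d)) : FieldConfig (EuclideanSpace ℝ (Fin d)) → ℂ) =
      shiftOp d (max t 0) F := rfl

/-- Semigroup law `V_{s+t} = V_s V_t` on `𝓔₊` for `s, t ≥ 0` (Glimm–Jaffe Thm 6.1.3 (i)). [folklore] -/
theorem shiftOpPos_add {s t : ℝ} (hs : 0 ≤ s) (ht : 0 ≤ t) :
    shiftOpPos d (s + t) = shiftOpPos d s ∘ₗ shiftOpPos d t := by
  apply LinearMap.ext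
  intro F
  apply Subtype.ext
  funext ω
  simp only [LinearMap.comp_apply, coe_shiftOpPos, shiftOp_apply, max_eq_left hs, max_eq_left ht,
    max_eq_left (add_nonneg hs ht), neg_add_rev, timeShiftField_add, ContinuousLinearMap.comp_apply]

variable (μ : Measure (FieldConfig (EuclideanSpace ℝ (Fin d))))

/-- The Osterwalder–Schrader form `b(F, G) = ∫ conj(F(θω)) G(ω) dμ(ω)` (Glimm–Jaffe (6.1.11)).
[folklore] -/
noncomputable def osForm (F G : FieldConfig (EuclideanSpace ℝ (Fin d)) → ℂ) : ℂ :=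
  ∫ ω, conj (F (thetaField d ω)) * G ω ∂μ

/-- `b(e_f, e_g) = S{g - θ f}` (Glimm–Jaffe (6.1.9)). [folklore] -/
theorem osForm_expObs (f g : 𝓢(EuclideanSpace ℝ (Fin d), ℝ)) :
    osForm μ (expObs f) (expObs g) = genFunctional μ (g - thetaTest d f) := by
  simp only [osForm, expObs_thetaField, conj_expObs, expObs_mul, neg_add_eq_sub, integral_expObs]

omit [NeZero d] in
/-- `conj S{h} = S{-h}`. [folklore] -/
theorem conj_genFunctional (h : 𝓢(EuclideanSpace ℝ (Fin d), ℝ)) :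
    conj (genFunctional μ h) = genFunctional μ (-h) := by
  rw [← integral_expObs, ← integral_conj]
  simp only [conj_expObs, integral_expObs]

variable {μ}

/-- The integrand of the OS form is integrable for continuous bounded observables. [folklore] -/
theorem integrable_osForm_integrand [IsFiniteMeasure μ]
    {F G : FieldConfig (EuclideanSpace ℝ (Fin d)) → ℂ} (hF : F ∈ posTimeSpan d)
    (hG : G ∈ posTimeSpan d) :
    Integrable (fun ω => conj (F (thetaField d ω)) * G ω) μ := by
  obtain ⟨hFc, C₁, hC₁⟩ := continuous_and_bounded_of_mem_posTimeSpan hF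
  obtain ⟨hGc, C₂, hC₂⟩ := continuous_and_bounded_of_mem_posTimeSpan hG
  refine integrable_of_continuous_of_bound
    ((Complex.continuous_conj.comp (hFc.comp (thetaField d).continuous)).mul hGc) (C₁ * C₂)
    fun ω => ?_
  rw [norm_mul, RCLike.norm_conj]
  exact mul_le_mul (hC₁ (thetaField d ω)) (hC₂ ω) (norm_nonneg _)
    ((norm_nonneg _).trans (hC₁ (thetaField d ω)))

/-- **Symmetry of time translation for the OS form** (Glimm–Jaffe Thm 6.1.3 (ii),
`⟨θ T(t) A, B⟩ = ⟨T(-t) θ A, B⟩ = ⟨θA, T(t) B⟩`): `b(V_t F, G) = b(F, V_t G)` under OS2.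
[cite: GlimmJaffeQP1987, Thm 6.1.3 (ii)] -/
theorem IsOS2Invariant.osForm_shiftOp (h2 : IsOS2Invariant μ) (t : ℝ)
    (F G : FieldConfig (EuclideanSpace ℝ (Fin d)) → ℂ) :
    osForm μ (shiftOp d t F) G = osForm μ F (shiftOp d t G) := by
  unfold osForm
  calc ∫ ω, conj (shiftOp d t F (thetaField d ω)) * G ω ∂μ
      = ∫ ω, (fun ω' => conj (F (thetaField d ω')) * shiftOp d t G ω') (timeShiftField d t ω) ∂μ := by
        congr 1
        funext ω
        simp only [shiftOp_apply, thetaField_timeShiftField, timeShiftField_neg_apply']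
    _ = ∫ ω, conj (F (thetaField d ω)) * shiftOp d t G ω ∂μ :=
        h2.integral_comp_timeShiftField t (fun ω' => conj (F (thetaField d ω')) * shiftOp d t G ω')

/-- The shifted correlation is a matrix element of the OS form:
`k_{θf, g}(t) = b(V_t e_f, e_g)`. [folklore] -/
theorem shiftCorr_thetaTest_eq_osForm (f g : 𝓢(EuclideanSpace ℝ (Fin d), ℝ)) (t : ℝ) :
    shiftCorr μ (thetaTest d f) g t = osForm μ (shiftOp d t (expObs f)) (expObs g) := by
  unfold shiftCorr osForm
  congr 1
  funext ω
  rw [shiftOp_apply, ← thetaField_timeShiftField, expObs_thetaField]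

/-- `b(e_f, V_t e_g) = S{-θf + T_t g}`. [folklore] -/
theorem osForm_expObs_shiftOp_expObs (f g : 𝓢(EuclideanSpace ℝ (Fin d), ℝ)) (t : ℝ) :
    osForm μ (expObs f) (shiftOp d t (expObs g)) =
      genFunctional μ (-thetaTest d f + timeShiftTest d t g) := by
  rw [shiftOp_expObs, osForm_expObs, neg_add_eq_sub]

variable (μ) in
/-- The OS form as a sesquilinear form on `𝓔₊` (conjugate-linear in the first argument).
Glimm–Jaffe (6.1.11). [folklore] -/
noncomputable def osSesq [IsFiniteMeasure μ] :
    ↥(posTimeSpan d) →ₗ⋆[ℂ] ↥(posTimeSpan d) →ₗ[ℂ] ℂ :=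
  LinearMap.mk₂'ₛₗ (starRingEnd ℂ) (RingHom.id ℂ)
    (fun F G => osForm μ (F : FieldConfig (EuclideanSpace ℝ (Fin d)) → ℂ) G)
    (fun F₁ F₂ G => by
      simp only [osForm, Submodule.coe_add, Pi.add_apply, map_add, add_mul]
      exact integral_add (integrable_osForm_integrand F₁.2 G.2)
        (integrable_osForm_integrand F₂.2 G.2))
    (fun c F G => by
      simp only [osForm, Submodule.coe_smul, Pi.smul_apply, smul_eq_mul, map_mul, mul_assoc]
      exact integral_const_mul _ _)
    (fun F G₁ G₂ => by
      simp only [osForm, Submodule.coe_add, Pi.add_apply, mul_add]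
      exact integral_add (integrable_osForm_integrand F.2 G₁.2)
        (integrable_osForm_integrand F.2 G₂.2))
    (fun c F G => by
      simp only [osForm, Submodule.coe_smul, Pi.smul_apply, smul_eq_mul, RingHom.id_apply,
        mul_left_comm _ c]
      exact integral_const_mul _ _)

/-- `osSesq μ F G = b(F, G)`. [folklore] -/
@[simp]
theorem osSesq_apply [IsFiniteMeasure μ] (F G : ↥(posTimeSpan d)) :
    osSesq μ F G = osForm μ (F : FieldConfig (EuclideanSpace ℝ (Fin d)) → ℂ) G := rfl

/-- Polarisation: a sesquilinear form with real diagonal is Hermitian. [folklore] -/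
theorem conj_symm_of_im_apply_self {V : Type*} [AddCommGroup V] [Module ℂ V]
    (B : V →ₗ⋆[ℂ] V →ₗ[ℂ] ℂ) (hB : ∀ v, (B v v).im = 0) (v w : V) : conj (B w v) = B v w := by
  have h1 := hB (v + w)
  have h2 := hB (v + I • w)
  have e1 : B (v + w) (v + w) = B v v + B v w + B w v + B w w := by
    simp only [map_add, LinearMap.add_apply]; abel
  have e2 : B (v + I • w) (v + I • w) = B v v + I * B v w - I * B w v + B w w := by
    simp only [map_add, LinearMap.add_apply, LinearMap.map_smulₛₗ, LinearMap.smul_apply, map_smul,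
      smul_eq_mul, Complex.conj_I]
    linear_combination (-(B w w)) * Complex.I_sq
  rw [e1] at h1
  rw [e2] at h2
  simp only [Complex.add_im, Complex.sub_im, Complex.mul_im, Complex.I_re, Complex.I_im, zero_mul,
    one_mul, zero_add, hB v, hB w, add_zero] at h1 h2
  apply Complex.ext
  · simp only [Complex.conj_re]; linarith
  · simp only [Complex.conj_im]; linarith

/-- **Reflection positivity on `𝓔₊`** (Glimm–Jaffe (6.1.8) ⇔ (6.1.9)): under OS3,
`b(F, F) ≥ 0` (real) for every `F ∈ 𝓔₊`; expanding `F = ∑ cᵢ e_{fᵢ}` gives the matrix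
`∑ c̄ᵢ cⱼ S{fⱼ - θfᵢ}` of (6.1.9). [cite: GlimmJaffeQP1987, §6.1 (6.1.8)-(6.1.9)] -/
theorem IsOS3ReflectionPositive.osSesq_self_nonneg [IsFiniteMeasure μ]
    (h3 : IsOS3ReflectionPositive d μ) (F : ↥(posTimeSpan d)) :
    0 ≤ (osSesq μ F F).re ∧ (osSesq μ F F).im = 0 := by
  classical
  obtain ⟨n, c, e, hF⟩ := Submodule.mem_span_set'.1 F.2
  have he : ∀ i, ∃ h : 𝓢(EuclideanSpace ℝ (Fin d), ℝ), IsPositiveTime h ∧ expObs h = (e i : _) :=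
    fun i => (e i).2
  choose h hh hhe using he
  -- expand `F` in the sesquilinear form
  set E : Fin n → ↥(posTimeSpan d) := fun i => ⟨expObs (h i), expObs_mem_posTimeSpan (hh i)⟩
    with hEdef
  have hE : ∀ i, (E i : FieldConfig (EuclideanSpace ℝ (Fin d)) → ℂ) = expObs (h i) := fun i => rfl
  have hFsum : F = ∑ i, c i • E i := by
    apply Subtype.ext
    rw [← hF, Submodule.coe_sum]
    refine Finset.sum_congr rfl fun i _ => ?_
    rw [Submodule.coe_smul, hE i, hhe i]
  have hexp : osSesq μ F F =
      ∑ i, ∑ j, conj (c i) * c j * genFunctional μ (h j - thetaTest d (h i)) := by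
    rw [hFsum]
    simp only [map_sum, LinearMap.sum_apply, LinearMap.map_smulₛₗ, LinearMap.smul_apply, map_smul,
      smul_eq_mul, osSesq_apply, hE, osForm_expObs, Finset.mul_sum]
    rw [Finset.sum_comm]
    refine Finset.sum_congr rfl fun i _ => Finset.sum_congr rfl fun j _ => ?_
    ring
  rw [hexp]
  exact h3 n c h hh

/-- The pre-inner-product-space core on `𝓔₊` given by the OS form under reflection positivity
(Glimm–Jaffe Prop. 6.1.1: `b` defines an inner product on `𝓔₊/𝒩`; here we keep the
semidefinite form on `𝓔₊` itself). [cite: GlimmJaffeQP1987, Prop. 6.1.1] -/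
@[reducible]
noncomputable def IsOS3ReflectionPositive.core [IsFiniteMeasure μ]
    (h3 : IsOS3ReflectionPositive d μ) : PreInnerProductSpace.Core ℂ ↥(posTimeSpan d) where
  inner F G := osSesq μ F G
  conj_inner_symm F G := conj_symm_of_im_apply_self (osSesq μ) (fun v => (h3.osSesq_self_nonneg v).2) F G
  re_inner_nonneg F := by simpa using (h3.osSesq_self_nonneg F).1
  add_left F₁ F₂ G := by simp only [map_add, LinearMap.add_apply]
  smul_left F G c := by simp only [LinearMap.map_smulₛₗ, LinearMap.smul_apply, smul_eq_mul]

end Reconstruction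

/-! ### Clustering for time-separated test functions -/

section Clustering

variable {μ : Measure (FieldConfig (EuclideanSpace ℝ (Fin d)))}

/-- **Ergodicity ⇒ clustering, time-separated case** (Glimm–Jaffe Thm 19.7.1 and the Remark
following it, made pointwise in `t`): for a probability law satisfying OS2, OS3 and OS4
(mean-ergodic form), and positive-time `f, g`,
`S{-θf + T_t g} = b(e_f, V_t e_g) → S{-θf} S{g}` as `t → +∞`. Proof: `b` is a positive
semidefinite Hermitian form on `𝓔₊` (OS3), `V_t` a symmetric bounded semigroup (OS2), so
`b(e_f, V_t e_g)` converges (`exists_tendsto_inner_semigroup`, GJ Thm 6.1.3); its Cesàro means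
converge to `conj(S{θf}) S{g}` by ergodicity (`IsOS4Ergodic.tendsto_cesaro_shiftCorr`), which
identifies the limit. [cite: GlimmJaffeQP1987, Thm 19.7.1] -/
theorem IsOS4Ergodic.tendsto_genFunctional_of_isPositiveTime [IsProbabilityMeasure μ]
    (h4 : IsOS4Ergodic d μ) (h2 : IsOS2Invariant μ) (h3 : IsOS3ReflectionPositive d μ)
    {f g : 𝓢(EuclideanSpace ℝ (Fin d), ℝ)} (hf : IsPositiveTime f) (hg : IsPositiveTime g) :
    Tendsto (fun t : ℝ => genFunctional μ (-thetaTest d f + timeShiftTest d t g)) atTop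
      (𝓝 (genFunctional μ (-thetaTest d f) * genFunctional μ g)) := by
  -- the pre-Hilbert structure on `𝓔₊` defined by the OS form
  letI core : PreInnerProductSpace.Core ℂ ↥(posTimeSpan d) := h3.core
  letI : SeminormedAddCommGroup ↥(posTimeSpan d) :=
    InnerProductSpace.Core.toSeminormedAddCommGroup (𝕜 := ℂ) (c := core)
  letI : InnerProductSpace ℂ ↥(posTimeSpan d) := InnerProductSpace.ofCore core
  have hinner : ∀ F G : ↥(posTimeSpan d),
      ⟪F, G⟫_ℂ = osForm μ (F : FieldConfig (EuclideanSpace ℝ (Fin d)) → ℂ) G := fun F G => rfl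
  -- hypotheses of the abstract semigroup lemma
  have hS : ∀ s t : ℝ, 0 ≤ s → 0 ≤ t →
      shiftOpPos d (s + t) = shiftOpPos d s ∘ₗ shiftOpPos d t :=
    fun s t hs ht => shiftOpPos_add hs ht
  have hsymm : ∀ t : ℝ, 0 ≤ t → ∀ F G : ↥(posTimeSpan d),
      ⟪shiftOpPos d t F, G⟫_ℂ = ⟪F, shiftOpPos d t G⟫_ℂ := by
    intro t _ F G
    rw [hinner, hinner, coe_shiftOpPos, coe_shiftOpPos]
    exact h2.osForm_shiftOp _ _ _
  have hbdd : ∀ F : ↥(posTimeSpan d), ∃ M : ℝ, ∀ t : ℝ, 0 ≤ t → ‖shiftOpPos d t F‖ ≤ M := by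
    intro F
    obtain ⟨-, C, hC⟩ := continuous_and_bounded_of_mem_posTimeSpan F.2
    refine ⟨|C|, fun t _ => ?_⟩
    have hsq : ‖shiftOpPos d t F‖ ^ 2 ≤ |C| ^ 2 := by
      rw [← inner_self_eq_norm_sq (𝕜 := ℂ), hinner, coe_shiftOpPos, sq_abs]
      refine (RCLike.re_le_norm _).trans ?_
      unfold osForm
      calc ‖∫ ω, conj (shiftOp d (max t 0) F (thetaField d ω)) * shiftOp d (max t 0) F ω ∂μ‖
          ≤ C * C * μ.real univ :=
            norm_integral_le_of_norm_le_const (ae_of_all _ fun ω => by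
              rw [norm_mul, RCLike.norm_conj, shiftOp_apply, shiftOp_apply]
              exact mul_le_mul (hC _) (hC _) (norm_nonneg _) ((norm_nonneg _).trans (hC ω)))
        _ = C ^ 2 := by simp [sq]
    exact (pow_le_pow_iff_left₀ (norm_nonneg _) (abs_nonneg C) two_ne_zero).1 hsq
  -- the two vectors
  let v : ↥(posTimeSpan d) := ⟨expObs f, expObs_mem_posTimeSpan hf⟩
  let w : ↥(posTimeSpan d) := ⟨expObs g, expObs_mem_posTimeSpan hg⟩
  obtain ⟨L, hL⟩ := exists_tendsto_inner_semigroup (𝕜 := ℂ) (shiftOpPos d) hS hsymm hbdd v w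
  -- matrix elements for `t ≥ 0`
  have hmat : ∀ t : ℝ, 0 ≤ t →
      ⟪v, shiftOpPos d t w⟫_ℂ = genFunctional μ (-thetaTest d f + timeShiftTest d t g) := by
    intro t ht
    rw [hinner, coe_shiftOpPos, max_eq_left ht]
    exact osForm_expObs_shiftOp_expObs f g t
  have hcorr : ∀ t : ℝ, 0 ≤ t → ⟪v, shiftOpPos d t w⟫_ℂ = shiftCorr μ (thetaTest d f) g t := by
    intro t ht
    rw [← hsymm t ht, hinner, coe_shiftOpPos, max_eq_left ht, shiftCorr_thetaTest_eq_osForm]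
  -- identification of the limit via the ergodic theorem
  have hk : Tendsto (shiftCorr μ (thetaTest d f) g) atTop (𝓝 L) :=
    hL.congr' ((eventually_ge_atTop 0).mono fun t ht => hcorr t ht)
  have hces := tendsto_inv_smul_intervalIntegral hk (intervalIntegrable_shiftCorr (thetaTest d f) g)
  have hLeq : L = conj (genFunctional μ (thetaTest d f)) * genFunctional μ g :=
    tendsto_nhds_unique hces (h4.tendsto_cesaro_shiftCorr (thetaTest d f) g)
  rw [conj_genFunctional] at hLeq
  rw [← hLeq]
  exact hL.congr' ((eventually_ge_atTop 0).mono fun t ht => hmat t ht)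

/-- **Ergodicity ⇒ clustering for time-separated test functions**: under OS2, OS3, OS4 (and
`μ` a probability law), if `θf` and `g` are positive-time then `S{f + T_t g} → S{f} S{g}` as
`t → +∞`. Glimm–Jaffe Thm 19.7.1 (Remark, (19.7.2)). [cite: GlimmJaffeQP1987, Thm 19.7.1] -/
theorem IsOS4Ergodic.tendsto_genFunctional_add_timeShiftTest [IsProbabilityMeasure μ]
    (h4 : IsOS4Ergodic d μ) (h2 : IsOS2Invariant μ) (h3 : IsOS3ReflectionPositive d μ)
    {f g : 𝓢(EuclideanSpace ℝ (Fin d), ℝ)} (hf : IsPositiveTime (thetaTest d f))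
    (hg : IsPositiveTime g) :
    Tendsto (fun t : ℝ => genFunctional μ (f + timeShiftTest d t g)) atTop
      (𝓝 (genFunctional μ f * genFunctional μ g)) := by
  have := h4.tendsto_genFunctional_of_isPositiveTime h2 h3 (isPositiveTime_neg hf) hg
  rwa [thetaTest_neg_thetaTest, neg_neg] at this

/-! ### Approximation by time-bounded test functions and the general case -/

variable (μ) in
/-- The `L¹` defect `δ(h) = ∫ |e_h - 1| dμ`, controlling `|S{h₁} - S{h₂}| ≤ δ(h₁ - h₂)`. [folklore] -/
noncomputable def expDefect (h : 𝓢(EuclideanSpace ℝ (Fin d), ℝ)) : ℝ :=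
  ∫ ω, ‖expObs h ω - 1‖ ∂μ

omit [NeZero d] in
/-- `δ(h) ≥ 0`. [folklore] -/
theorem expDefect_nonneg (h : 𝓢(EuclideanSpace ℝ (Fin d), ℝ)) : 0 ≤ expDefect μ h :=
  integral_nonneg fun _ => norm_nonneg _

omit [NeZero d] in
/-- `|S{h₁} - S{h₂}| ≤ δ(h₁ - h₂)`. [folklore] -/
theorem norm_genFunctional_sub_le [IsProbabilityMeasure μ] (h₁ h₂ : 𝓢(EuclideanSpace ℝ (Fin d), ℝ)) :
    ‖genFunctional μ h₁ - genFunctional μ h₂‖ ≤ expDefect μ (h₁ - h₂) := by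
  have hint : ∀ h : 𝓢(EuclideanSpace ℝ (Fin d), ℝ), Integrable (expObs h) μ := fun h =>
    integrable_of_continuous_of_bound (continuous_expObs h) 1 fun ω => (norm_expObs h ω).le
  rw [← integral_expObs, ← integral_expObs, ← integral_sub (hint h₁) (hint h₂)]
  have hpt : ∀ ω, expObs h₁ ω - expObs h₂ ω = expObs h₂ ω * (expObs (h₁ - h₂) ω - 1) := by
    intro ω
    rw [mul_sub, mul_one, expObs_mul, add_sub_cancel]
  simp_rw [hpt]
  refine (norm_integral_le_integral_norm _).trans (le_of_eq ?_)
  unfold expDefect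
  congr 1
  funext ω
  rw [norm_mul, norm_expObs, one_mul]

omit [NeZero d] in
/-- `δ(p + q) ≤ δ(p) + δ(q)`. [folklore] -/
theorem expDefect_add_le [IsFiniteMeasure μ] (p q : 𝓢(EuclideanSpace ℝ (Fin d), ℝ)) :
    expDefect μ (p + q) ≤ expDefect μ p + expDefect μ q := by
  have hint : ∀ h : 𝓢(EuclideanSpace ℝ (Fin d), ℝ), Integrable (fun ω => ‖expObs h ω - 1‖) μ :=
    fun h => ((integrable_of_continuous_of_bound (continuous_expObs h) 1
      fun ω => (norm_expObs h ω).le).sub (integrable_const 1)).norm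
  unfold expDefect
  rw [← integral_add (hint p) (hint q)]
  refine integral_mono (hint _) ((hint p).add (hint q)) fun ω => ?_
  have : expObs (p + q) ω - 1 = expObs p ω * (expObs q ω - 1) + (expObs p ω - 1) := by
    rw [← expObs_mul]; ring
  rw [this]
  refine (norm_add_le _ _).trans ?_
  rw [norm_mul, norm_expObs, one_mul, add_comm]

/-- `δ(T_s q) = δ(q)` under OS2. [folklore] -/
theorem IsOS2Invariant.expDefect_timeShiftTest (h2 : IsOS2Invariant μ) (s : ℝ)
    (q : 𝓢(EuclideanSpace ℝ (Fin d), ℝ)) : expDefect μ (timeShiftTest d s q) = expDefect μ q := by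
  unfold expDefect
  have : (fun ω => ‖expObs (timeShiftTest d s q) ω - 1‖) =
      fun ω => (fun ω' => ‖expObs q ω' - 1‖) (timeShiftField d (-s) ω) := by
    funext ω
    simp only [expObs_timeShiftField, neg_neg]
  rw [this]
  exact h2.integral_comp_timeShiftField (-s) (fun ω' => ‖expObs q ω' - 1‖)

/-- `S{T_s h} = S{h}` under OS2. [folklore] -/
theorem IsOS2Invariant.genFunctional_timeShiftTest (h2 : IsOS2Invariant μ) (s : ℝ)
    (h : 𝓢(EuclideanSpace ℝ (Fin d), ℝ)) :
    genFunctional μ (timeShiftTest d s h) = genFunctional μ h := by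
  rw [← integral_expObs, ← integral_expObs]
  have : expObs (timeShiftTest d s h) = fun ω => expObs h (timeShiftField d (-s) ω) := by
    funext ω
    rw [expObs_timeShiftField, neg_neg]
  rw [this]
  exact h2.integral_comp_timeShiftField (-s) (expObs h)

omit [NeZero d] in
/-- If `u m → f` in `𝓢` then `δ(f - u m) → 0` (dominated convergence: `ω(f - u m) → 0` for
every tempered distribution `ω`). [folklore] -/
theorem tendsto_expDefect_of_tendsto [IsFiniteMeasure μ] {f : 𝓢(EuclideanSpace ℝ (Fin d), ℝ)}
    {u : ℕ → 𝓢(EuclideanSpace ℝ (Fin d), ℝ)} (hu : Tendsto u atTop (𝓝 f)) :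
    Tendsto (fun m => expDefect μ (f - u m)) atTop (𝓝 0) := by
  have h0 : Tendsto (fun m => f - u m) atTop (𝓝 0) := by
    simpa using (tendsto_const_nhds (x := f)).sub hu
  have hlim : ∀ ω : FieldConfig (EuclideanSpace ℝ (Fin d)),
      Tendsto (fun m => ‖expObs (f - u m) ω - 1‖) atTop (𝓝 0) := by
    intro ω
    have h1 : Tendsto (fun m => ω (f - u m)) atTop (𝓝 0) := by
      have hc := ((map_continuous ω).tendsto (0 : 𝓢(EuclideanSpace ℝ (Fin d), ℝ))).comp h0
      rw [map_zero] at hc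
      exact hc
    have h2 : Continuous fun x : ℝ => ‖cexp (I * (x : ℂ)) - 1‖ := by fun_prop
    simpa only [expObs, Function.comp_def, ofReal_zero, mul_zero, Complex.exp_zero, sub_self,
      norm_zero] using (h2.tendsto 0).comp h1
  have := tendsto_integral_of_dominated_convergence (μ := μ) (fun _ => (2 : ℝ))
    (F := fun m ω => ‖expObs (f - u m) ω - 1‖) (f := fun _ => (0 : ℝ))
    (fun m => (((continuous_expObs (f - u m)).sub continuous_const).norm).aestronglyMeasurable)
    (integrable_const _)
    (fun m => ae_of_all _ fun ω => by
      rw [Real.norm_of_nonneg (norm_nonneg _)]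
      exact (norm_sub_le _ _).trans (by rw [norm_expObs, norm_one]; norm_num))
    (ae_of_all _ hlim)
  simpa [expDefect] using this

/-- A cutoff supported in `closedBall 0 R`, shifted forward in time by `a > R`, is positive-time.
[folklore] -/
theorem isPositiveTime_timeShiftTest_of_tsupport_subset {u : 𝓢(EuclideanSpace ℝ (Fin d), ℝ)}
    {R a : ℝ} (hu : tsupport (u : EuclideanSpace ℝ (Fin d) → ℝ) ⊆ Metric.closedBall 0 R)
    (ha : R < a) : IsPositiveTime (timeShiftTest d a u) := by
  intro x hx
  have hx' : x ∈ tsupport (fun y => u (y - EuclideanSpace.single 0 a)) := by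
    have : (timeShiftTest d a u : EuclideanSpace ℝ (Fin d) → ℝ) =
        fun y => u (y - EuclideanSpace.single 0 a) := funext fun y => timeShiftTest_apply d a u y
    rwa [this] at hx
  have h : x - EuclideanSpace.single 0 a ∈
      Metric.closedBall (0 : EuclideanSpace ℝ (Fin d)) R :=
    hu (tsupport_schwartz_comp_subset u
      (continuous_id.sub continuous_const : Continuous fun y : EuclideanSpace ℝ (Fin d) =>
        y - EuclideanSpace.single 0 a) hx')
  rw [Metric.mem_closedBall, dist_zero_right] at h
  have hcoord := (PiLp.norm_apply_le (x - EuclideanSpace.single 0 a :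
    EuclideanSpace ℝ (Fin d)) 0).trans h
  have h1 : (x - EuclideanSpace.single 0 a : EuclideanSpace ℝ (Fin d)) 0 = x 0 - a := by
    simp
  rw [h1, Real.norm_eq_abs, abs_le] at hcoord
  simp only [mem_setOf_eq]
  linarith [hcoord.1]

/-- A cutoff supported in `closedBall 0 R`, shifted backward in time by `a > R`, is
negative-time (`θ` of it is positive-time). [folklore] -/
theorem isPositiveTime_thetaTest_timeShiftTest_of_tsupport_subset
    {u : 𝓢(EuclideanSpace ℝ (Fin d), ℝ)} {R a : ℝ}
    (hu : tsupport (u : EuclideanSpace ℝ (Fin d) → ℝ) ⊆ Metric.closedBall 0 R) (ha : R < a) :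
    IsPositiveTime (thetaTest d (timeShiftTest d (-a) u)) := by
  intro x hx
  have hx' : x ∈ tsupport (fun y => u (timeReflection d y - EuclideanSpace.single 0 (-a))) := by
    have : (thetaTest d (timeShiftTest d (-a) u) : EuclideanSpace ℝ (Fin d) → ℝ) =
        fun y => u (timeReflection d y - EuclideanSpace.single 0 (-a)) := by
      funext y
      rw [thetaTest_apply, timeShiftTest_apply]
    rwa [this] at hx
  have h : timeReflection d x - EuclideanSpace.single 0 (-a) ∈
      Metric.closedBall (0 : EuclideanSpace ℝ (Fin d)) R :=
    hu (tsupport_schwartz_comp_subset u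
      ((timeReflection d).continuous.sub continuous_const :
        Continuous fun y : EuclideanSpace ℝ (Fin d) =>
          timeReflection d y - EuclideanSpace.single 0 (-a)) hx')
  rw [Metric.mem_closedBall, dist_zero_right] at h
  have hcoord := (PiLp.norm_apply_le (timeReflection d x - EuclideanSpace.single 0 (-a) :
    EuclideanSpace ℝ (Fin d)) 0).trans h
  have h1 : (timeReflection d x - EuclideanSpace.single 0 (-a) : EuclideanSpace ℝ (Fin d)) 0 =
      -x 0 + a := by
    simp [timeReflection_apply]
  rw [h1, Real.norm_eq_abs, abs_le] at hcoord
  simp only [mem_setOf_eq]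
  linarith [hcoord.2]

/-- **Discharge of `IsOS4Ergodic.clustering`: ergodicity implies clustering.** For a probability
law on `𝒮'(ℝ^d)` satisfying OS2 (Euclidean invariance), OS3 (reflection positivity) and OS4
(mean ergodicity of time translations), the generating functional clusters:
`S{f + T_t g} → S{f} S{g}` as `t → +∞` for all real test functions `f, g`.
Glimm–Jaffe Thm 19.7.1 (with the Remark following it) gives the equivalence of OS4 with uniqueness
of the invariant vector and with (Cesàro) clustering for `A ∈ 𝓔₋`, `B ∈ 𝓔₊`; the pointwise limit
follows from the strong convergence of the contraction semigroup of Thm 6.1.3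
(`exists_tendsto_inner_semigroup`), and general `f, g` are reached by compactly supported cutoffs
(`exists_tsupport_subset_closedBall_tendsto`) moved to negative/positive times with OS2, the error
being uniform in `t` (`|S{h₁} - S{h₂}| ≤ δ(h₁ - h₂)`, `δ` translation invariant).
[cite: GlimmJaffeQP1987, §6.1 and Thm. 19.7.1] -/
theorem IsOS4Ergodic.clustering_holds : IsOS4Ergodic.clustering (d := d) := by
  intro μ _ h4 h2 h3 f g
  rw [Metric.tendsto_atTop]
  intro ε hε
  obtain ⟨u, hu_supp, hu⟩ := exists_tsupport_subset_closedBall_tendsto f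
  obtain ⟨u', hu'_supp, hu'⟩ := exists_tsupport_subset_closedBall_tendsto g
  -- choose the cutoff index `m`
  have hδ : Tendsto (fun m => expDefect μ (f - u m) + expDefect μ (g - u' m)) atTop (𝓝 0) := by
    simpa using (tendsto_expDefect_of_tendsto (μ := μ) hu).add
      (tendsto_expDefect_of_tendsto (μ := μ) hu')
  obtain ⟨m, hm⟩ := (Metric.tendsto_atTop.1 hδ) (ε / 3) (by positivity)
  have hm' : expDefect μ (f - u m) + expDefect μ (g - u' m) < ε / 3 := by
    have := hm m le_rfl
    rwa [Real.dist_eq, sub_zero, abs_of_nonneg (add_nonneg (expDefect_nonneg _) (expDefect_nonneg _))]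
      at this
  -- clustering for the time-separated cutoffs
  obtain ⟨a, ha⟩ : ∃ a : ℝ, 2 * ((m : ℝ) + 1) < a := ⟨_, lt_add_one _⟩
  have hF : IsPositiveTime (thetaTest d (timeShiftTest d (-a) (u m))) :=
    isPositiveTime_thetaTest_timeShiftTest_of_tsupport_subset (hu_supp m) ha
  have hG : IsPositiveTime (timeShiftTest d a (u' m)) :=
    isPositiveTime_timeShiftTest_of_tsupport_subset (hu'_supp m) ha
  have hclus := h4.tendsto_genFunctional_add_timeShiftTest h2 h3 hF hG
  rw [h2.genFunctional_timeShiftTest, h2.genFunctional_timeShiftTest] at hclus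
  have hshift : ∀ t : ℝ, genFunctional μ (timeShiftTest d (-a) (u m) +
      timeShiftTest d t (timeShiftTest d a (u' m))) =
      genFunctional μ (u m + timeShiftTest d (t + 2 * a) (u' m)) := by
    intro t
    rw [← h2.genFunctional_timeShiftTest (-a) (u m + timeShiftTest d (t + 2 * a) (u' m)), map_add,
      ← timeShiftTest_add, ← timeShiftTest_add, show -a + (t + 2 * a) = t + a by ring]
  simp_rw [hshift] at hclus
  have hclus' : Tendsto (fun t : ℝ => genFunctional μ (u m + timeShiftTest d t (u' m))) atTop
      (𝓝 (genFunctional μ (u m) * genFunctional μ (u' m))) := by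
    have := hclus.comp (tendsto_atTop_add_const_right atTop (-(2 * a)) tendsto_id)
    refine this.congr fun t => ?_
    simp only [Function.comp_apply, id_eq, neg_add_cancel_right]
  obtain ⟨T₀, hT₀⟩ := (Metric.tendsto_atTop.1 hclus') (ε / 3) (by positivity)
  refine ⟨T₀, fun t ht => ?_⟩
  -- the three-epsilon estimate
  have h1 : ‖genFunctional μ (f + timeShiftTest d t g) -
      genFunctional μ (u m + timeShiftTest d t (u' m))‖ < ε / 3 := by
    refine (norm_genFunctional_sub_le _ _).trans_lt ?_
    have : f + timeShiftTest d t g - (u m + timeShiftTest d t (u' m)) =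
        (f - u m) + timeShiftTest d t (g - u' m) := by
      rw [map_sub]; abel
    rw [this]
    refine (expDefect_add_le _ _).trans_lt ?_
    rwa [h2.expDefect_timeShiftTest]
  have h2' : dist (genFunctional μ (u m + timeShiftTest d t (u' m)))
      (genFunctional μ (u m) * genFunctional μ (u' m)) < ε / 3 := hT₀ t ht
  have h3' : ‖genFunctional μ (u m) * genFunctional μ (u' m) - genFunctional μ f * genFunctional μ g‖
      < ε / 3 := by
    have : genFunctional μ (u m) * genFunctional μ (u' m) - genFunctional μ f * genFunctional μ g =
        (genFunctional μ (u m) - genFunctional μ f) * genFunctional μ (u' m) +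
          genFunctional μ f * (genFunctional μ (u' m) - genFunctional μ g) := by ring
    rw [this]
    refine (norm_add_le _ _).trans_lt ?_
    rw [norm_mul, norm_mul]
    have hb1 : ‖genFunctional μ (u m) - genFunctional μ f‖ ≤ expDefect μ (f - u m) := by
      rw [norm_sub_rev]; exact norm_genFunctional_sub_le _ _
    have hb2 : ‖genFunctional μ (u' m) - genFunctional μ g‖ ≤ expDefect μ (g - u' m) := by
      rw [norm_sub_rev]; exact norm_genFunctional_sub_le _ _
    calc ‖genFunctional μ (u m) - genFunctional μ f‖ * ‖genFunctional μ (u' m)‖ +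
          ‖genFunctional μ f‖ * ‖genFunctional μ (u' m) - genFunctional μ g‖
        ≤ expDefect μ (f - u m) * 1 + 1 * expDefect μ (g - u' m) :=
          add_le_add (mul_le_mul hb1 (norm_genFunctional_le_one _ _) (norm_nonneg _)
            (expDefect_nonneg _))
            (mul_le_mul (norm_genFunctional_le_one _ _) hb2 (norm_nonneg _) zero_le_one)
      _ < ε / 3 := by linarith
  rw [dist_eq_norm] at h2' ⊢
  have t1 := norm_sub_le_norm_sub_add_norm_sub (genFunctional μ (f + timeShiftTest d t g))
    (genFunctional μ (u m + timeShiftTest d t (u' m))) (genFunctional μ f * genFunctional μ g)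
  have t2 := norm_sub_le_norm_sub_add_norm_sub (genFunctional μ (u m + timeShiftTest d t (u' m)))
    (genFunctional μ (u m) * genFunctional μ (u' m)) (genFunctional μ f * genFunctional μ g)
  linarith

/-- Discharge of `IsOSMeasure.clustering`: an OS measure satisfies the clustering form of OS4
(from `IsOS4Ergodic.clustering_holds`). Glimm–Jaffe §6.1, §19.7. [cite: GlimmJaffeQP1987, Thm 19.7.1] -/
theorem IsOSMeasure.clustering_holds : IsOSMeasure.clustering (d := d) := by
  intro μ hμ
  haveI := hμ.isProbabilityMeasure
  exact IsOS4Ergodic.clustering_holds hμ.os4 hμ.os2 hμ.os3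

end Clustering

end Literature.MathematicalPhysics.QuantumLattice
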